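import Summits.QuantumFields.YangMills.Theorems.BalabanUVNodesN07ChartTopBoxPlaquetteValues
import HarnessLib

/-!
# N07 [B11] (= [15] = [Balaban1985Variational]) Sect. F — «NOW WE USE THE ASSUMPTION (7) FOR V» (p. 303) ON THE CHART's TOP BOX, PART 2: WHICH LEVEL-`j` PLAQUETTES OF `M^j U` ARE
# PRINT's (7) PLAQUETTES AND WHICH ARE ONCE-AVERAGED LEVEL-`(j−1)` DATA ((13)) — «(7) for V» on a box of good labels with `δ̂` δ-LINEAR (the chart lane's item (C1a),
# OUTWARD-MEET-EDITION-SPEC §10; generic in `Ω`, `W`, `U`; the record instance is MODULE 69b)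

Cell `pub-ymgap`, seat `pub-ymgap-dag-n07-e` g24 (FAN-OUT §N07 row s3; LANE OWNER of the K0 road), MODULE 69a part 2.  `--kind proof --supports stmt-QuantumFields-20541 --as helper`
(K0⁷); count-neutral; def-free.  [15] = [Balaban1985Variational]; [3] = [Balaban1985Averaging]; [III] = [Balaban1988Convergent]; [6] = [Balaban1985RegularSpaces].

CONTINUES PART 1 (`…N07ChartTopBoxPlaquetteValues`: GOOD vertices, the dichotomy `corner_dichotomy`, `M^j U(∂p′) = (7)-field(∂p′)` on good plaquettes).  Here, for `j = m + 1 ≤ k`: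
* TOUCHING PLAQUETTES (§4 ★★★ `dist1_plaqHol_iter_succ_lt_of_touching`): if a vertex lies in `Γ_j^{(j)}`, `p′` is a PRINTED (7) plaquette (`Sect2.printedPlaqs`: touching `Γ_j`, no bond
  inside `Ω_{j+1}` by the margin clause) ⇒ `|M^j U(∂p′) − 1| < δ_j` from the data's level-`j` clause `PlaqSmallOn (printedPlaqs Ω k j) δ_j ((7)-field)`.
* NON-TOUCHING PLAQUETTES (§4 ★★★ `dist1_plaqHol_iter_succ_lt_of_not_touching`): otherwise every level-`m` plaquette based in the four corner blocks has all its vertices in `Γ_m^{(m)}`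
  (the dichotomy's second branch at the four vertices — the labels of `[x, x + e_μ + e_ν]`, PART 1 `mem_Icc_two_of_mem_Icc`), is a printed (7) plaquette of level `m` on which the (7) field IS
  `W_m = M^m U`, hence is `δ_m`-small (level `m ≥ 1`: the data's level-`m` clause; `m = 0`: the top-domain clause `printedPlaqsTop Ω Ω₀ k`, the plaquette meets the support `Ω₀` — clause
  (iii): every fine point of the unit boxes lies in `Ω₀`); MODULE 68's TIGHT-HULL Prop. 1 (`dist1_plaqHol_avOfRecord_lt_of_cornerBlocks`) then gives `|M^j U(∂p′) − 1| < C_L·δ_m`,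
  `C_L = (L² + 6((d+2)L)²)·(4(d−1)(2L−1) + 1)` — print's (13) «the form (2)» for the once-averaged data `V̄`, crude constant.
* ALL PLAQUETTES (§5 ★★★ `plaqSmallOn_boxPlaqs_iter_succ`): for an integer box `[tlo, thi]` of good labels (margin (i), collar (ii) for `m ≥ 1`, support (iii) for `m = 0`),
  `PlaqSmallOn (boxPlaqs tlo thi) (δ_j + C_L·δ_m) (Averaging.iter (avOfRecord F N K) (m+1) U)` — MODULE 62's letter `hV` in its own shape.  Guards: `0 ≤ δ_j`, `0 < δ_m`, `2L < N_m`,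
  MODULE 68's `δ_N`-guard `(((d+2)L)²∕4)·((4(d−1)(2L−1) + 1)·δ_m) < δ_N`.

WHAT IS PROVED (sorry-free; no definition; axioms standard; by-name composition — NOTHING of [15]∕[3]∕[6] analysis beyond MODULE 68's crude Prop. 1).
§4 ★★★ `dist1_plaqHol_iter_succ_lt_of_touching`, ★★★ `dist1_plaqHol_iter_succ_lt_of_not_touching`; §5 ★★★ `plaqSmallOn_boxPlaqs_iter_succ`.

HONEST SCOPE.  Count-neutral; the data hypothesis (7) (`Sect2.DataSmall7PTop`'s clauses, passed separately), the fibre `AgreeOn`, block saturation, the margin∕collar∕support clauses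
(i)–(iii) and MODULE 68's guards are HYPOTHESES of these theorems (69b discharges (i)–(iii) and saturation at the record; (7) and the fibre stay the token's hypotheses); nothing of Bałaban
asserted; `δ̂` ∕ HS3NORM ∕ HCHART-MEET-NORM stay displayed in the knit; K0⁷ ∕ K1⁹ NOT closed; N07 NOT discharged; counts unmoved (typed 28∕28 · discharged 5∕27); one finite 𝕋⁴ programme at fixed
ε — the route closes the conditional finite-𝕋⁴ rung `BalabanLadder.UV` ONLY; the YM mass gap (Clay) is NOT proved by any of this; nothing continuum ∕ ℝ⁴ ∕ OS.  No `sorry`, no `def`, no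
`instance`, no `notation`.

References: [15] (7) p. 278 L20–33, (13) p. 280, (144) p. 300, (147) p. 301, (160) p. 303; [3] Prop. 1 (51) pp. 25–26; [III] p. 255, (2.2) p. 255, (2.10)–(2.11) p. 256; [6] p. 98.
-/

set_option autoImplicit false

noncomputable section
open scoped BigOperators Matrix.Norms.L2Operator

namespace Summit.QuantumFields.YangMills.BalabanUVNodes.N07ChartTopBoxPlaquettes

open Literature.MathematicalPhysics.QuantumFieldTheory.Balaban1983to89
open Literature.MathematicalPhysics.QuantumFieldTheory.Balaban1983to89.Node00
open Literature.MathematicalPhysics.QuantumFieldTheory.Balaban1983to89.B15DeterminingSets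
open T4Continuum (T4Family)
open T4AxialGaugeSmallField (castSite castSite_apply castSite_add_e boxPlaqs)
open B15Eq112TorusCover (cover)
open B14DomainGeom (Pt)
open B7Prop1Explicit (e e_apply)
open B8Eq131Cubes (box bLo bHi)
open B5Eq118OneStroke (iterBlockOf iterBlockOf_succ)
open GaugeField (plaqHol)
open ExpMeanLog (deltaSU)
open BlockAveraging (blockAvg_avg)
open Literature.MathematicalPhysics.QuantumLattice (blockMap)
open B8Eq17ClassAkV1 (plaqsOf mem_plaqsOf)
open Summit.QuantumFields.YangMills.BalabanUVNodes.N07DataDownTheTowerBlowDown (blockOf_mem_box_of_mem_blowDown ediv_mem_Icc_of_mem_blowDown)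
open Summit.QuantumFields.YangMills.BalabanUVNodes.N07AveragedPlaquetteCornerBlocks (castSite_eq_coverAt mem_blowDown_of_blockOf_mem_box corner_mem_box₂
  dist1_plaqHol_avOfRecord_lt_of_cornerBlocks)
open Summit.QuantumFields.YangMills.BalabanUVNodes.N07ChartTopBoxPlaquetteValues (iterBlockOf_cover_of_mem_unitBox embIter_castSite_mem_unitBox
  embIter_mem_unitBox_of_blockOf_eq mem_Icc_two_of_mem_Icc corner_dichotomy iter_succ_eq_mixedField_of_corners plaqHol_iter_succ_eq_mixedField)

/-! ## §4  The two cases: touching plaquettes are printed (7) plaquettes; non-touching ones are once-averaged level-`m` data -/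

section Cases

variable (F : T4Family) (N : ℕ) [NeZero N] (K : ℕ) {m k : ℕ} (Ω : ℕ → Set (Site (F.P K) 0)) (W : MSField (F.P K) (SU N)) (U : GaugeField (F.P K) 0 (SU N))

/-- ★★★ **A TOUCHING CHART-BOX PLAQUETTE IS A PRINTED (7) PLAQUETTE, HENCE `δ`-SMALL**: all four vertices good and off `Ω_{m+2}^{(m+1)}`, one of them in `Γ_{m+1}` ⇒
`|M^{m+1}U(∂p′) − 1| < δ` from the data's level-`(m+1)` clause `PlaqSmallOn (printedPlaqs Ω k (m+1)) δ ((7)-field)`.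
[cite: Balaban1985Variational, (7) p.278 L20–33, (160) p.303 («Now we use the assumption (7) for V»)] -/
theorem dist1_plaqHol_iter_succ_lt_of_touching (hm : m + 1 ≤ (F.P K).m + (F.P K).K) (hfib : AgreeOn (genSet Ω k) (avgFamily (avOfRecord F N K) U) W)
    {δ : ℝ} (h7 : PlaqSmallOn (Sect2.printedPlaqs Ω k (m + 1)) δ (Sect2.mixedField (avOfRecord F N K) (genSet Ω k (m + 1)) (W (m + 1)) (W m)))
    (p : Plaq (F.P K) (m + 1))
    (hgood : ∀ y : Site (F.P K) (m + 1), (y = p.src ∨ y = p.src.shift p.μ ∨ y = p.src.shift p.ν ∨ y = (p.src.shift p.μ).shift p.ν) →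
      (y ∈ genSet Ω k (m + 1) ∨ ∀ y' : Site (F.P K) m, blockOf y' = y → y' ∈ genSet Ω k m))
    (hoff : ∀ y : Site (F.P K) (m + 1), (y = p.src ∨ y = p.src.shift p.μ ∨ y = p.src.shift p.ν ∨ y = (p.src.shift p.μ).shift p.ν) →
      y ∉ pts (m + 1) (Ω (m + 2)))
    (htouch : p ∈ plaqsOf (genSet Ω k (m + 1))) :
    dist1 (plaqHol (Averaging.iter (avOfRecord F N K) (m + 1) U) p) < δ := by
  rw [plaqHol_iter_succ_eq_mixedField F N K Ω W U hm hfib p hgood]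
  refine h7 p ⟨htouch, ?_, ?_, ?_, ?_⟩
  · exact fun h => hoff _ (Or.inl rfl) h.1
  · exact fun h => hoff _ (Or.inr (Or.inl rfl)) h.1
  · exact fun h => hoff _ (Or.inr (Or.inr (Or.inl rfl))) h.1
  · exact fun h => hoff _ (Or.inl rfl) h.1

/-- ★★★ **A NON-TOUCHING CHART-BOX PLAQUETTE IS ONCE-AVERAGED LEVEL-`m` DATA, HENCE `C_L·δ`-SMALL** ((13) «the form (2)» for `V̄`): if NO vertex of `p′ = ⟨castSite x, μ, ν⟩` lies in
`Γ_{m+1}` and every label of `[x, x + e_μ + e_ν]` is good (§2's second branch then holds at all four vertices), then every level-`m` plaquette based in the four corner blocks has all its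
vertices in `Γ_m^{(m)}` — so it is a printed (7) plaquette of level `m` on which the (7) field IS `W_m = M^m U` — and MODULE 68's tight-hull Prop. 1 applies: for `m ≥ 1` from the data's
level-`m` clause, for `m = 0` from the top-domain clause (the plaquette meets `Ω₀`, hypothesis `hsupp`).  Guards: MODULE 68's (`0 < a`, `2L < N_m`, the `δ_N`-guard).
[cite: Balaban1985Variational, (7) p.278, (13) p.280, (160) p.303; Balaban1985Averaging, Prop. 1 (51) pp.25–26; Balaban1988Convergent, p.255] -/
theorem dist1_plaqHol_iter_succ_lt_of_not_touching (hmk : m + 1 ≤ k) (hm : m + 1 ≤ (F.P K).m + (F.P K).K)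
    (hfib : AgreeOn (genSet Ω k) (avgFamily (avOfRecord F N K) U) W)
    {a : ℝ} (ha : 0 < a) (hN : 2 * (F.P K).L < (F.P K).sitesPerDir m)
    (ht : (((((F.P K).d + 2) * (F.P K).L : ℕ) : ℝ) ^ 2 / 4) * ((4 * (((((F.P K).d - 1 : ℕ) : ℝ)) * ((2 * (F.P K).L - 1 : ℕ) : ℝ)) + 1) * a) < deltaSU (Fin N))
    (h7m : 1 ≤ m → ∀ q : Plaq (F.P K) m, q ∈ Sect2.printedPlaqs Ω k m → (∀ c : PBond (F.P K) m,
        (c = ⟨q.src, q.μ⟩ ∨ c = ⟨q.src.shift q.μ, q.ν⟩ ∨ c = ⟨q.src.shift q.ν, q.μ⟩ ∨ c = ⟨q.src, q.ν⟩) → c ∈ bondsOf (genSet Ω k m)) → dist1 (plaqHol (W m) q) < a)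
    {Ω₀ : Set (Site (F.P K) 0)} (h70 : m = 0 → PlaqSmallOn (Sect2.printedPlaqsTop Ω Ω₀ k) a (W 0))
    (x : Pt (F.P K).d) {μ ν : Fin (F.P K).d} (hμν : μ < ν)
    (hgood2 : ∀ t ∈ Set.Icc x (x + e μ + e ν), ∀ y' : Site (F.P K) m, blockOf y' = (castSite t : Site (F.P K) (m + 1)) → y' ∈ genSet Ω k m)
    (hsupp : m = 0 → ∀ t ∈ Set.Icc x (x + e μ + e ν), ∀ z ∈ box (F.P K).L t 1 (m + 1), cover (F.P K) z ∈ Ω₀) :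
    dist1 (plaqHol (Averaging.iter (avOfRecord F N K) (m + 1) U) ⟨castSite x, μ, ν, hμν⟩) <
      (((F.P K).L : ℝ) ^ 2 + 6 * ((((F.P K).d + 2) * (F.P K).L : ℕ) : ℝ) ^ 2) * ((4 * (((((F.P K).d - 1 : ℕ) : ℝ)) * ((2 * (F.P K).L - 1 : ℕ) : ℝ)) + 1) * a) := by
  -- `M^{m+1} U = M(M^m U)`; MODULE 68 at `V = M^m U`
  show dist1 (plaqHol ((avOfRecord F N K m).avg (Averaging.iter (avOfRecord F N K) m U)) ⟨castSite x, μ, ν, hμν⟩) < _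
  refine dist1_plaqHol_avOfRecord_lt_of_cornerBlocks F N K hm ha hN ht _ x hμν fun q hq => ?_
  -- a level-`m` plaquette based in the blow-down box: all four vertices lie below labels of `[x, x + e_μ + e_ν]`, hence in `Γ_m`
  obtain ⟨w, hwlo, hwhi, hwsrc⟩ := hq
  have hL1 : (1 : ℤ) ≤ (F.P K).L := by exact_mod_cast (F.P K).L_pos
  have heμ : ∀ κ i : Fin (F.P K).d, (0 : ℤ) ≤ e κ i ∧ e κ i ≤ 1 := fun κ i => by rw [e_apply]; split_ifs <;> norm_num
  -- the four vertices of `q` as labels in the blow-down box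
  have hvert : ∀ w' : Pt (F.P K).d, (w' = w ∨ w' = w + e q.μ ∨ w' = w + e q.ν ∨ w' = w + e q.μ + e q.ν) →
      (castSite w' : Site (F.P K) m) ∈ genSet Ω k m := by
    intro w' hw'
    have hw'box : w' ∈ Set.Icc (fun i => ((F.P K).L : ℤ) * x i) (fun i => ((F.P K).L : ℤ) * (x + e μ + e ν) i + (((F.P K).L : ℤ) - 1)) := by
      constructor <;> intro i
      · have := hwlo i
        rcases hw' with rfl | rfl | rfl | rfl <;> simp only [Pi.add_apply] <;> linarith [(heμ q.μ i).1, (heμ q.ν i).1]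
      · have := hwhi i
        simp only [Pi.add_apply] at this
        rcases hw' with rfl | rfl | rfl | rfl <;> simp only [Pi.add_apply] <;> linarith [(heμ q.μ i).1, (heμ q.ν i).1]
    -- its block is `castSite ⌊w′∕L⌋`, a label of `[x, x + e_μ + e_ν]`
    have hblk := blockOf_mem_box_of_mem_blowDown hm (⟨w', hw'box, rfl⟩ :
      (castSite w' : Site (F.P K) m) ∈ (castSite '' Set.Icc (fun i => ((F.P K).L : ℤ) * x i) (fun i => ((F.P K).L : ℤ) * (x + e μ + e ν) i + (((F.P K).L : ℤ) - 1)) : Set (Site (F.P K) m)))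
    obtain ⟨t, htI, htb⟩ := hblk
    exact hgood2 t htI (castSite w') htb.symm
  have h1 := hvert w (Or.inl rfl)
  have h2 : (castSite w : Site (F.P K) m).shift q.μ ∈ genSet Ω k m := by rw [← castSite_add_e]; exact hvert _ (Or.inr (Or.inl rfl))
  have h3 : (castSite w : Site (F.P K) m).shift q.ν ∈ genSet Ω k m := by rw [← castSite_add_e]; exact hvert _ (Or.inr (Or.inr (Or.inl rfl)))
  have h4 : ((castSite w : Site (F.P K) m).shift q.μ).shift q.ν ∈ genSet Ω k m := by
    rw [← castSite_add_e, ← castSite_add_e]; exact hvert _ (Or.inr (Or.inr (Or.inr rfl)))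
  -- all four bonds of `q` meet `Γ_m`: the fibre gives `M^m U = W_m` on them
  have hbonds : ∀ c : PBond (F.P K) m, (c = ⟨q.src, q.μ⟩ ∨ c = ⟨q.src.shift q.μ, q.ν⟩ ∨ c = ⟨q.src.shift q.ν, q.μ⟩ ∨ c = ⟨q.src, q.ν⟩) →
      c ∈ bondsOf (genSet Ω k m) := by
    intro c hc
    rw [hwsrc] at hc
    rcases hc with rfl | rfl | rfl | rfl
    · exact Or.inl h1
    · exact Or.inl h2
    · exact Or.inl h3
    · exact Or.inl h1
  have hf : ∀ c : PBond (F.P K) m, c ∈ bondsOf (genSet Ω k m) → Averaging.iter (avOfRecord F N K) m U c = W m c := fun c hc => hfib m c hc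
  have hplaq : plaqHol (Averaging.iter (avOfRecord F N K) m U) q = plaqHol (W m) q := by
    unfold GaugeField.plaqHol
    rw [hf _ (hbonds _ (Or.inl rfl)), hf _ (hbonds _ (Or.inr (Or.inl rfl))), hf _ (hbonds _ (Or.inr (Or.inr (Or.inl rfl)))),
      hf _ (hbonds _ (Or.inr (Or.inr (Or.inr rfl))))]
  rw [hplaq]
  -- `Γ_m` misses `Ω_{m+1}`: `q` has no bond inside `Ω_{m+1}`
  have hΓ : ∀ y : Site (F.P K) m, y ∈ genSet Ω k m → y ∉ pts m (Ω (m + 1)) := by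
    intro y hy habs
    have hy' : embIter m y ∈ gammaRegion Ω k m := (mem_pts.1 hy)
    rw [mem_pts] at habs
    rcases Nat.eq_zero_or_pos m with h0 | h0
    · subst h0; rw [gammaRegion_zero Ω (by omega)] at hy'; exact hy' habs
    · rw [gammaRegion_mid Ω h0 (by omega)] at hy'; exact hy'.2 habs
  have hprinted : q ∈ Sect2.printedPlaqs Ω k m := by
    refine ⟨?_, fun h => hΓ _ h1 (hwsrc ▸ h.1), fun h => hΓ _ h2 (hwsrc ▸ h.1), fun h => hΓ _ h3 (hwsrc ▸ h.1), fun h => hΓ _ h1 (hwsrc ▸ h.1)⟩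
    rw [mem_plaqsOf, hwsrc]; exact Or.inl h1
  rcases Nat.eq_zero_or_pos m with h0 | h0
  · -- level `0`: the top-domain clause; the plaquette meets `Ω₀` at its lower corner
    subst h0
    refine h70 rfl q ⟨hprinted, ?_⟩
    rw [mem_plaqsOf, hwsrc]
    left
    -- the lower corner `cover w` lies in the unit box of its label `⌊w∕L⌋ ∈ [x, x + e_μ + e_ν]`
    have hwbox : w ∈ Set.Icc (fun i => ((F.P K).L : ℤ) * x i) (fun i => ((F.P K).L : ℤ) * (x + e μ + e ν) i + (((F.P K).L : ℤ) - 1)) :=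
      ⟨hwlo, fun i => by have := hwhi i; simp only [Pi.add_apply] at this ⊢; linarith [(heμ q.μ i).1, (heμ q.ν i).1]⟩
    have htI := ediv_mem_Icc_of_mem_blowDown (F.P K).L_pos hwbox
    have hunit : w ∈ box (F.P K).L (fun i => w i / ((F.P K).L : ℤ)) 1 (0 + 1) := by
      intro i
      simp only [bLo, bHi, Nat.cast_zero, sub_zero, add_zero, Nat.cast_one, zero_add, pow_one]
      have hL0 : (0 : ℤ) < (F.P K).L := by exact_mod_cast (F.P K).L_pos
      constructor
      · have := Int.ediv_mul_le (w i) hL0.ne'; linarith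
      · have := Int.lt_ediv_add_one_mul_self (w i) hL0; linarith
    have := hsupp rfl _ htI w hunit
    exact this
  · exact h7m h0 q hprinted hbonds

end Cases

/-! ## §5  All plaquettes of an integer box of good labels -/

section All

variable (F : T4Family) (N : ℕ) [NeZero N] (K : ℕ) {m k : ℕ} (Ω : ℕ → Set (Site (F.P K) 0)) (W : MSField (F.P K) (SU N)) (U : GaugeField (F.P K) 0 (SU N))

/-- ★★★ **«(7) FOR V» ON A BOX OF GOOD LABELS**: on the fibre `M˙(U)|_𝔅 = W` with the data's level-`(m+1)` clause at `δ₁` and level-`m` clause at `a` (top-domain clause for `m = 0`),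
block saturation of `Ω_{m+1}`, and an integer box `[tlo, thi]` of level-`(m+1)` labels whose unit boxes (margin) carry no point of `Ω_{m+2}`, (collar, `m ≥ 1`) project into `Ω_m`,
(support, `m = 0`) project into `Ω₀`: EVERY level-`(m+1)` plaquette of `M^{m+1} U` based in the box is `< δ₁ + C_L·a`, `C_L = (L² + 6((d+2)L)²)·(4(d−1)(2L−1) + 1)` — MODULE 62's letter `δ̂`
in its own shape `PlaqSmallOn (boxPlaqs tlo thi) δ̂ (Averaging.iter (avOfRecord F N K) (m+1) U)`.  Guards: `0 ≤ δ₁`, `0 < a`, `2L < N_m`, MODULE 68's `δ_N`-guard.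
[cite: Balaban1985Variational, (7) p.278 L20–33, (13) p.280, (147) p.301, (160) p.303; Balaban1985Averaging, Prop. 1 (51) pp.25–26; Balaban1988Convergent, p.255, (2.2), (2.10) pp.255–256] -/
theorem plaqSmallOn_boxPlaqs_iter_succ (hmk : m + 1 ≤ k) (hm : m + 1 ≤ (F.P K).m + (F.P K).K)
    (hfib : AgreeOn (genSet Ω k) (avgFamily (avOfRecord F N K) U) W)
    (hsat : ∀ x x' : Site (F.P K) 0, iterBlockOf (m + 1) x = iterBlockOf (m + 1) x' → x ∈ Ω (m + 1) → x' ∈ Ω (m + 1))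
    {δ₁ a : ℝ} (hδ₁ : 0 ≤ δ₁) (ha : 0 < a) (hN : 2 * (F.P K).L < (F.P K).sitesPerDir m)
    (ht : (((((F.P K).d + 2) * (F.P K).L : ℕ) : ℝ) ^ 2 / 4) * ((4 * (((((F.P K).d - 1 : ℕ) : ℝ)) * ((2 * (F.P K).L - 1 : ℕ) : ℝ)) + 1) * a) < deltaSU (Fin N))
    (h7succ : PlaqSmallOn (Sect2.printedPlaqs Ω k (m + 1)) δ₁ (Sect2.mixedField (avOfRecord F N K) (genSet Ω k (m + 1)) (W (m + 1)) (W m)))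
    (h7m : ∀ m', m' + 1 = m → PlaqSmallOn (Sect2.printedPlaqs Ω k (m' + 1)) a (Sect2.mixedField (avOfRecord F N K) (genSet Ω k (m' + 1)) (W (m' + 1)) (W m')))
    {Ω₀ : Set (Site (F.P K) 0)} (h70 : m = 0 → PlaqSmallOn (Sect2.printedPlaqsTop Ω Ω₀ k) a (W 0))
    {tlo thi : Pt (F.P K).d}
    (hfar : ∀ t ∈ Set.Icc tlo thi, ∀ z ∈ box (F.P K).L t 1 (m + 1), cover (F.P K) z ∉ Ω (m + 2))
    (hcol : 1 ≤ m → ∀ t ∈ Set.Icc tlo thi, ∀ z ∈ box (F.P K).L t 1 (m + 1), cover (F.P K) z ∈ Ω m)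
    (hsupp : m = 0 → ∀ t ∈ Set.Icc tlo thi, ∀ z ∈ box (F.P K).L t 1 (m + 1), cover (F.P K) z ∈ Ω₀) :
    PlaqSmallOn (boxPlaqs tlo thi) (δ₁ + (((F.P K).L : ℝ) ^ 2 + 6 * ((((F.P K).d + 2) * (F.P K).L : ℕ) : ℝ) ^ 2) *
      ((4 * (((((F.P K).d - 1 : ℕ) : ℝ)) * ((2 * (F.P K).L - 1 : ℕ) : ℝ)) + 1) * a)) (Averaging.iter (avOfRecord F N K) (m + 1) U) := by
  intro p hp
  obtain ⟨x, hxlo, hxhi, hsrc⟩ := hp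
  have hC : 0 ≤ (((F.P K).L : ℝ) ^ 2 + 6 * ((((F.P K).d + 2) * (F.P K).L : ℕ) : ℝ) ^ 2) *
      ((4 * (((((F.P K).d - 1 : ℕ) : ℝ)) * ((2 * (F.P K).L - 1 : ℕ) : ℝ)) + 1) * a) := by positivity
  have heμ : ∀ κ i : Fin (F.P K).d, (0 : ℤ) ≤ e κ i := fun κ i => by rw [e_apply]; split_ifs <;> norm_num
  -- every label of `[x, x + e_μ + e_ν]` is in `[tlo, thi]`, hence good
  have hlab : ∀ t ∈ Set.Icc x (x + e p.μ + e p.ν), t ∈ Set.Icc tlo thi := fun t ht =>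
    ⟨fun i => le_trans (hxlo i) (ht.1 i), fun i => le_trans (ht.2 i) (hxhi i)⟩
  have hdich : ∀ t ∈ Set.Icc x (x + e p.μ + e p.ν),
      (castSite t : Site (F.P K) (m + 1)) ∈ genSet Ω k (m + 1) ∨ ∀ y : Site (F.P K) m, blockOf y = (castSite t : Site (F.P K) (m + 1)) → y ∈ genSet Ω k m :=
    fun t htI => corner_dichotomy Ω hmk hm hsat (hfar t (hlab t htI)) (fun h1 => hcol h1 t (hlab t htI))
  -- the four vertices as labels
  have hxI : x ∈ Set.Icc x (x + e p.μ + e p.ν) := ⟨le_rfl, fun i => by simp only [Pi.add_apply]; linarith [heμ p.μ i, heμ p.ν i]⟩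
  have hxμI : x + e p.μ ∈ Set.Icc x (x + e p.μ + e p.ν) :=
    ⟨fun i => by simp only [Pi.add_apply]; linarith [heμ p.μ i], fun i => by simp only [Pi.add_apply]; linarith [heμ p.ν i]⟩
  have hxνI : x + e p.ν ∈ Set.Icc x (x + e p.μ + e p.ν) :=
    ⟨fun i => by simp only [Pi.add_apply]; linarith [heμ p.ν i], fun i => by simp only [Pi.add_apply]; linarith [heμ p.μ i]⟩
  have hxμνI : x + e p.μ + e p.ν ∈ Set.Icc x (x + e p.μ + e p.ν) := ⟨fun i => by simp only [Pi.add_apply]; linarith [heμ p.μ i, heμ p.ν i], le_rfl⟩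
  have hverts : ∀ y : Site (F.P K) (m + 1), (y = p.src ∨ y = p.src.shift p.μ ∨ y = p.src.shift p.ν ∨ y = (p.src.shift p.μ).shift p.ν) →
      ∃ t ∈ Set.Icc x (x + e p.μ + e p.ν), y = castSite t := by
    intro y hy
    rcases hy with rfl | rfl | rfl | rfl
    · exact ⟨x, hxI, hsrc⟩
    · exact ⟨x + e p.μ, hxμI, by rw [hsrc, castSite_add_e]⟩
    · exact ⟨x + e p.ν, hxνI, by rw [hsrc, castSite_add_e]⟩
    · exact ⟨x + e p.μ + e p.ν, hxμνI, by rw [hsrc, castSite_add_e, castSite_add_e]⟩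
  have hgood : ∀ y : Site (F.P K) (m + 1), (y = p.src ∨ y = p.src.shift p.μ ∨ y = p.src.shift p.ν ∨ y = (p.src.shift p.μ).shift p.ν) →
      (y ∈ genSet Ω k (m + 1) ∨ ∀ y' : Site (F.P K) m, blockOf y' = y → y' ∈ genSet Ω k m) := by
    intro y hy
    obtain ⟨t, htI, rfl⟩ := hverts y hy
    exact hdich t htI
  -- no vertex lies in `Ω_{m+2}^{(m+1)}` (margin at the vertex's own centre)
  have hoff : ∀ y : Site (F.P K) (m + 1), (y = p.src ∨ y = p.src.shift p.μ ∨ y = p.src.shift p.ν ∨ y = (p.src.shift p.μ).shift p.ν) →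
      y ∉ pts (m + 1) (Ω (m + 2)) := by
    intro y hy habs
    obtain ⟨t, htI, rfl⟩ := hverts y hy
    obtain ⟨xc, hxc, hce⟩ := embIter_castSite_mem_unitBox hm t
    rw [mem_pts, hce] at habs
    exact hfar t (hlab t htI) xc hxc habs
  by_cases htouch : p ∈ plaqsOf (genSet Ω k (m + 1))
  · -- touching: a printed (7) plaquette
    have h := dist1_plaqHol_iter_succ_lt_of_touching F N K Ω W U hm hfib h7succ p hgood hoff htouch
    linarith
  · -- non-touching: once-averaged level-`m` data on the four corner blocks
    have hgood2 : ∀ t ∈ Set.Icc x (x + e p.μ + e p.ν), ∀ y' : Site (F.P K) m, blockOf y' = (castSite t : Site (F.P K) (m + 1)) → y' ∈ genSet Ω k m := by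
      intro t htI y' hy'
      rcases hdich t htI with h | h
      · -- this label IS a vertex of `p′`: contradiction with non-touching
        exfalso
        apply htouch
        rw [mem_plaqsOf, hsrc]
        rcases mem_Icc_two_of_mem_Icc p.hμν.ne htI with rfl | rfl | rfl | rfl
        · exact Or.inl h
        · exact Or.inr (Or.inl (by rw [← castSite_add_e]; exact h))
        · exact Or.inr (Or.inr (Or.inl (by rw [← castSite_add_e]; exact h)))
        · exact Or.inr (Or.inr (Or.inr (by rw [← castSite_add_e, ← castSite_add_e]; exact h)))
      · exact h y' hy'
    have h7m' : 1 ≤ m → ∀ q : Plaq (F.P K) m, q ∈ Sect2.printedPlaqs Ω k m → (∀ c : PBond (F.P K) m,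
        (c = ⟨q.src, q.μ⟩ ∨ c = ⟨q.src.shift q.μ, q.ν⟩ ∨ c = ⟨q.src.shift q.ν, q.μ⟩ ∨ c = ⟨q.src, q.ν⟩) → c ∈ bondsOf (genSet Ω k m)) → dist1 (plaqHol (W m) q) < a := by
      intro h1 q hq hb
      obtain ⟨m', rfl⟩ : ∃ m', m = m' + 1 := ⟨m - 1, by omega⟩
      have h7 := h7m m' rfl q hq
      have heq : plaqHol (Sect2.mixedField (avOfRecord F N K) (genSet Ω k (m' + 1)) (W (m' + 1)) (W m')) q = plaqHol (W (m' + 1)) q := by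
        unfold GaugeField.plaqHol
        rw [Sect2.mixedField_of_mem _ _ _ (hb _ (Or.inl rfl)), Sect2.mixedField_of_mem _ _ _ (hb _ (Or.inr (Or.inl rfl))),
          Sect2.mixedField_of_mem _ _ _ (hb _ (Or.inr (Or.inr (Or.inl rfl)))), Sect2.mixedField_of_mem _ _ _ (hb _ (Or.inr (Or.inr (Or.inr rfl))))]
      rwa [heq] at h7
    obtain ⟨src, μ, ν, hμν⟩ := p
    simp only at hsrc
    subst hsrc
    have h := dist1_plaqHol_iter_succ_lt_of_not_touching F N K Ω W U hmk hm hfib ha hN ht h7m' h70 x hμν hgood2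
      (fun h0 t htI z hz => hsupp h0 t (hlab t htI) z hz)
    linarith

end All

end Summit.QuantumFields.YangMills.BalabanUVNodes.N07ChartTopBoxPlaquettes

end
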